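import Summits.HodgeConjecture.CorCM.Census.BlockParityHodgeFamilies

/-!
# The coinvariant fibre `φ₂(G, c)` of the face lattice, I: pairs, the Hodge span, reduction mod `2`, the invariant

COR-CM (cell `pub-hodgecm2`), count-neutral kernel combinatorics by the binder seat b09 (gen 29; lane COINVARIANT-FLOOR),
part I.  Bookkeeping definitions + theorems; no `decide`, no certificate, no named fact, no `sorry`; `Interfaces.lean` (C1),
every E term, B01, `Transposition/*` untouched.  HONEST FRAMING: `HC_CM` is NOT proved, here or anywhere in the tree; nothing
here is a period or a headline.

THE SETTING is the abstract currency of `CorCM/Prior/AllgGroup1.lean` and `Census/BlockParityLaw.lean`: `G` a finite group,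
`c : G` an involution (`c * c = 1`; central where stated), `CMF G c` the abstract CM types, `ℤ[types] = CMF G c →₀ ℤ`, the face
relations `gface Φ t t'` (`gfaceSet`), and the base change `rt c Q` (`Ψ ↦ Ψ·Q⁻¹`), acting on `ℤ[types]` by `Finsupp.mapDomain`.

WHY.  André-3's uniform law (PORTFOLIO-g15 §0 (D), checked on every Galois CM type of order `≤ 20`) reads
`μ = μ_F = fibre₂ := dim_𝔽₂ (Λ ⊗ 𝔽₂)_G`, where `Λ = H/P` is the Hodge lattice modulo pairs and `μ` (`μ_F`) the minimal number of
`G`-orbits of Hodge vectors (of faces) generating `Λ` over `ℤ[G]`.  Parts I–III of gen 28 (`Census/BlockParity*`) proved the PARITY floor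
`μ ≥ β − 1 − δ` and that it is all a base-change-invariant functional on `ℤ[types]` can give; part VIII supplied the engine for ONE
functional invariant on the Hodge lattice only.  This lane takes ALL of them at once: the universal such functional is the
projection to the coinvariant fibre, whose dimension `φ₂(G, c)` is defined here as a choice-free invariant of `(G, c)`; part II
(`Census/CoinvariantFloor.lean`) proves `|S| ≥ φ₂ ≥ β − 1 − δ`; part III (`Census/CoinvariantTwoGroups.lean`): for `2`-groups the
floor is attained mod `2` by faces.

CONTENT.
* §1 **Pairs and the Hodge span.**  `pair Ψ = [Ψ] + [Ψ·c]` (`= [Ψ] + [Ψ̄]` for central `c`, `BlockParity.rt_self_val`), `pairSet`,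
  and `hodgeSpan = ℤ⟨faces⟩ + ℤ⟨pairs⟩`.  For central `c ≠ 1` this is EXACTLY the lattice of integer Hodge vectors
  `{y | typeSum y constant}` (`typeSum_pair`, `exists_forall_typeSum_eq_of_mem_hodgeSpan`, `mem_hodgeSpan_of_forall_typeSum_eq`;
  the face half is the prior programme's `gfaces_generate`: `ℤ⟨faces⟩ = ker typeSum`).
* §2 **Reduction mod 2** `red : ℤ[types] → 𝔽₂[types]` (`red_single`, `red_mapDomain`).
* §3 **The mod-2 lattices** inside `𝔽₂[types]`: `face2 = 𝔽₂⟨faces⟩`, `pair2 = 𝔽₂⟨pairs⟩`, the coboundaries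
  `aug2 = 𝔽₂⟨f·Q⁻¹ − f : f a face⟩ = I_G·face2`, `hodge2 = face2 + pair2`, `rad2 = pair2 + aug2 ≤ hodge2` (`rad2_le_hodge2`), all
  base-change stable (`mapDomain_rt_mem_face2/pair2/hodge2`), and the key closure property `mapDomain_rt_sub_mem_rad2`:
  `x·Q⁻¹ − x ∈ rad2` for every `x ∈ hodge2` (coboundaries of Hodge vectors are coboundaries of faces plus pairs).
* §4 **The coinvariant fibre** `φ₂(G, c) = fibreTwo c hc2 := dim_𝔽₂ (hodge2 / rad2)` — for central `c ≠ 1` this is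
  `dim_𝔽₂ (Λ ⊗ 𝔽₂)_G = dim_𝔽₂ Λ/(I_G Λ + 2Λ)` (`Λ = hodgeSpan / ℤ⟨pairs⟩`, saturated in `ℤ[types]`), André-3's `fibre₂` (numerically,
  gen 28 `fibre*.py`: `ℤ/6 1 · ℤ/8 1 · Q₈ 2 · ℤ/10 3 · ℤ/12 5 · ℤ/14 9 · ℤ/16 15 · Q₁₆ 16 · ℤ/18 29 · ℤ/20 51 · ℤ/2×ℤ/10 54 · D₁₀ 66` = `μ`
  in every row of the atlas).  `finrank_rad2_add_fibreTwo`: `dim rad2 + φ₂ = dim hodge2`.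

## References
* [Pohlmann1968] H. Pohlmann, Algebraic cycles on abelian varieties of complex multiplication type, Ann. of Math. 88 (1968), Thm 1.
-/

namespace Summit.HodgeConjecture.CorCM.Census.Coinvariant

open Finset
open Summit.HodgeConjecture.CorCM.Prior.AllgGroup.RfwfAllgGroup
open Summit.HodgeConjecture.CorCM.Census.BlockParity

noncomputable section

variable {G : Type*} [Group G] [Fintype G] [DecidableEq G] (c : G)

/-! ## §1 Pairs and the Hodge span -/

/-- **The pair** `[Ψ] + [Ψ·c]` of an abstract CM type (for central `c` this is `[Ψ] + [Ψ̄]`, the class of the divisor pair).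
[folklore] -/
def pair (Ψ : CMF G c) : CMF G c →₀ ℤ := Finsupp.single Ψ 1 + Finsupp.single (rt c c Ψ) 1

/-- The set of all pairs `[Ψ] + [Ψ·c]`. [folklore] -/
def pairSet : Set (CMF G c →₀ ℤ) := Set.range (pair c)

/-- The pair of `Ψ` lies in `pairSet`. [folklore] -/
theorem pair_mem_pairSet (Ψ : CMF G c) : pair c Ψ ∈ pairSet c := ⟨Ψ, rfl⟩

/-- **The Hodge span** `H = ℤ⟨faces⟩ + ℤ⟨pairs⟩ ⊆ ℤ[types]` (for central `c ≠ 1`: the integer Hodge vectors, §1 below). [folklore] -/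
def hodgeSpan (hc2 : c * c = 1) : Submodule ℤ (CMF G c →₀ ℤ) :=
  Submodule.span ℤ (gfaceSet G c hc2) ⊔ Submodule.span ℤ (pairSet c)

/-- Faces lie in the Hodge span. [folklore] -/
theorem gfaceSet_subset_hodgeSpan (hc2 : c * c = 1) : gfaceSet G c hc2 ⊆ ↑(hodgeSpan c hc2) := fun _ hy =>
  Submodule.mem_sup_left (Submodule.subset_span hy)

/-- Pairs lie in the Hodge span. [folklore] -/
theorem pair_mem_hodgeSpan (hc2 : c * c = 1) (Ψ : CMF G c) : pair c Ψ ∈ hodgeSpan c hc2 :=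
  Submodule.mem_sup_right (Submodule.subset_span (pair_mem_pairSet c Ψ))

/-- For central `c`, **the type sum of a pair is the constant `1`** (`1_Ψ + 1_{Ψ̄} = 1`). [folklore] -/
theorem typeSum_pair (hcen : ∀ x : G, x * c = c * x) (Ψ : CMF G c) (x : G) : typeSum G c (pair c Ψ) x = 1 := by
  rw [pair, map_add, typeSum_single, typeSum_single, Pi.add_apply]
  have h2 : indG (rt c c Ψ).1 x = indG Ψ.1 (c * x) := by
    unfold indG
    rw [← hcen x]
    by_cases h : x * c ∈ Ψ.1
    · rw [if_pos ((mem_rt c c Ψ x).mpr h), if_pos h]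
    · rw [if_neg (fun h' => h ((mem_rt c c Ψ x).mp h')), if_neg h]
  rw [h2]
  exact indG_pair c Ψ x

/-- The face span is killed by the type sum (the easy half of `gfaces_generate`, no `c ≠ 1` needed). [folklore] -/
theorem typeSum_eq_zero_of_mem_span_gfaceSet (hc2 : c * c = 1) {y : CMF G c →₀ ℤ}
    (hy : y ∈ Submodule.span ℤ (gfaceSet G c hc2)) : typeSum G c y = 0 := by
  have hle : Submodule.span ℤ (gfaceSet G c hc2) ≤ LinearMap.ker (typeSum G c) := by
    rw [Submodule.span_le]
    rintro _ ⟨Φ, t, t', ht', rfl⟩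
    exact LinearMap.mem_ker.mpr (typeSum_gface c hc2 Φ ht')
  exact LinearMap.mem_ker.mp (hle hy)

/-- For central `c`, the span of the pairs has constant type sums. [folklore] -/
theorem exists_forall_typeSum_eq_of_mem_span_pairSet (hcen : ∀ x : G, x * c = c * x) {y : CMF G c →₀ ℤ}
    (hy : y ∈ Submodule.span ℤ (pairSet c)) : ∃ k : ℤ, ∀ x : G, typeSum G c y x = k := by
  induction hy using Submodule.span_induction with
  | mem y hy =>
    obtain ⟨Ψ, rfl⟩ := hy
    exact ⟨1, typeSum_pair c hcen Ψ⟩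
  | zero => exact ⟨0, fun x => by rw [map_zero]; rfl⟩
  | add y z _ _ hy hz =>
    obtain ⟨k, hk⟩ := hy
    obtain ⟨l, hl⟩ := hz
    exact ⟨k + l, fun x => by rw [map_add, Pi.add_apply, hk, hl]⟩
  | smul a y _ hy =>
    obtain ⟨k, hk⟩ := hy
    exact ⟨a * k, fun x => by rw [map_smul, Pi.smul_apply, hk, smul_eq_mul]⟩

/-- **Hodge vectors have constant type sum** (central `c`): every `y ∈ hodgeSpan` has `typeSum y = k·𝟙`. [folklore] -/
theorem exists_forall_typeSum_eq_of_mem_hodgeSpan (hc2 : c * c = 1) (hcen : ∀ x : G, x * c = c * x)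
    {y : CMF G c →₀ ℤ} (hy : y ∈ hodgeSpan c hc2) : ∃ k : ℤ, ∀ x : G, typeSum G c y x = k := by
  obtain ⟨f, hf, q, hq, rfl⟩ := Submodule.mem_sup.mp hy
  obtain ⟨k, hk⟩ := exists_forall_typeSum_eq_of_mem_span_pairSet c hcen hq
  exact ⟨k, fun x => by rw [map_add, Pi.add_apply, typeSum_eq_zero_of_mem_span_gfaceSet c hc2 hf, hk, Pi.zero_apply, zero_add]⟩

/-- **Conversely** (central `c ≠ 1`): a vector with constant type sum `k·𝟙` is a Hodge vector — it is `k` pairs plus an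
element of `ker typeSum = ℤ⟨faces⟩` (`gfaces_generate`). [folklore] -/
theorem mem_hodgeSpan_of_forall_typeSum_eq (hc2 : c * c = 1) (hc1 : c ≠ 1) (hcen : ∀ x : G, x * c = c * x)
    {y : CMF G c →₀ ℤ} {k : ℤ} (hy : ∀ x : G, typeSum G c y x = k) : y ∈ hodgeSpan c hc2 := by
  obtain ⟨Φ, hΦ⟩ := exists_isCMF c hc2 hc1
  have hker : y - k • pair c ⟨Φ, hΦ⟩ ∈ Submodule.span ℤ (gfaceSet G c hc2) := by
    rw [gfaces_generate c hc2 hc1, LinearMap.mem_ker, map_sub, map_smul]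
    funext x
    rw [Pi.sub_apply, Pi.smul_apply, hy, typeSum_pair c hcen, smul_eq_mul, mul_one, Pi.zero_apply, sub_self]
  have e : y = (y - k • pair c ⟨Φ, hΦ⟩) + k • pair c ⟨Φ, hΦ⟩ := by abel
  rw [e]
  exact Submodule.add_mem _ (Submodule.mem_sup_left hker)
    (Submodule.smul_mem _ _ (pair_mem_hodgeSpan c hc2 ⟨Φ, hΦ⟩))

/-- **The Hodge span is the lattice of integer Hodge vectors** (central `c ≠ 1`): `y ∈ hodgeSpan ↔ typeSum y` is constant.
[folklore] -/
theorem mem_hodgeSpan_iff (hc2 : c * c = 1) (hc1 : c ≠ 1) (hcen : ∀ x : G, x * c = c * x) (y : CMF G c →₀ ℤ) :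
    y ∈ hodgeSpan c hc2 ↔ ∃ k : ℤ, ∀ x : G, typeSum G c y x = k :=
  ⟨exists_forall_typeSum_eq_of_mem_hodgeSpan c hc2 hcen, fun ⟨_, hk⟩ => mem_hodgeSpan_of_forall_typeSum_eq c hc2 hc1 hcen hk⟩

/-- For central `c`, **the base change of a pair is a pair**: `(pair Ψ)·Q⁻¹ = pair (Ψ·Q⁻¹)`. [folklore] -/
theorem mapDomain_rt_pair_eq (hcen : ∀ x : G, x * c = c * x) (Q : G) (Ψ : CMF G c) :
    Finsupp.mapDomain (rt c Q) (pair c Ψ) = pair c (rt c Q Ψ) := by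
  rw [pair, pair, Finsupp.mapDomain_add, Finsupp.mapDomain_single, Finsupp.mapDomain_single, ← rt_mul, ← rt_mul, hcen Q]

/-- For central `c`, **the Hodge span is base-change stable.** [folklore] -/
theorem mapDomain_rt_mem_hodgeSpan (hc2 : c * c = 1) (hcen : ∀ x : G, x * c = c * x) (Q : G) {y : CMF G c →₀ ℤ}
    (hy : y ∈ hodgeSpan c hc2) : Finsupp.mapDomain (rt c Q) y ∈ hodgeSpan c hc2 := by
  obtain ⟨f, hf, q, hq, rfl⟩ := Submodule.mem_sup.mp hy
  rw [Finsupp.mapDomain_add]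
  refine Submodule.add_mem _ (Submodule.mem_sup_left (mapDomain_rt_mem_span_gfaceSet c hc2 Q hf))
    (Submodule.mem_sup_right ?_)
  have h : Submodule.map (Finsupp.lmapDomain ℤ ℤ (rt c Q)) (Submodule.span ℤ (pairSet c)) ≤ Submodule.span ℤ (pairSet c) := by
    rw [Submodule.map_span, Submodule.span_le]
    rintro _ ⟨_, ⟨Ψ, rfl⟩, rfl⟩
    rw [Finsupp.lmapDomain_apply, mapDomain_rt_pair_eq c hcen]
    exact Submodule.subset_span (pair_mem_pairSet c _)
  exact h (Submodule.mem_map_of_mem hq)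

/-! ## §2 Reduction mod 2 -/

/-- **Reduction mod 2** `ℤ[types] → 𝔽₂[types]`. [folklore] -/
def red : (CMF G c →₀ ℤ) →ₗ[ℤ] (CMF G c →₀ ZMod 2) :=
  (Finsupp.mapRange.addMonoidHom (Int.castAddHom (ZMod 2))).toIntLinearMap

/-- `red` is `mapRange` of the cast `ℤ → 𝔽₂`. [folklore] -/
theorem red_apply (y : CMF G c →₀ ℤ) : red c y = Finsupp.mapRange (fun n : ℤ => (n : ZMod 2)) (Int.cast_zero) y := rfl

/-- `red [Ψ]·n = [Ψ]·(n mod 2)`. [folklore] -/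
@[simp] theorem red_single (Ψ : CMF G c) (n : ℤ) : red c (Finsupp.single Ψ n) = Finsupp.single Ψ (n : ZMod 2) := by
  rw [red_apply, Finsupp.mapRange_single]

/-- **Reduction commutes with base change** (and with any relabelling of types). [folklore] -/
theorem red_mapDomain (f : CMF G c → CMF G c) (y : CMF G c →₀ ℤ) :
    red c (Finsupp.mapDomain f y) = Finsupp.mapDomain f (red c y) := by
  rw [red_apply, red_apply]
  exact (Finsupp.mapDomain_mapRange f y (fun n : ℤ => (n : ZMod 2)) Int.cast_zero (fun a b => Int.cast_add a b)).symm

/-- The reduction of a pair. [folklore] -/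
theorem red_pair (Ψ : CMF G c) : red c (pair c Ψ) = Finsupp.single Ψ 1 + Finsupp.single (rt c c Ψ) 1 := by
  rw [pair, map_add, red_single, red_single, Int.cast_one]

/-! ## §3 The mod-2 lattices: faces, pairs, coboundaries, the Hodge lattice and the radical -/

/-- The faces mod `2`. [folklore] -/
def faces2 (hc2 : c * c = 1) : Set (CMF G c →₀ ZMod 2) := red c '' gfaceSet G c hc2

/-- `face2 = 𝔽₂⟨faces⟩`, the face lattice mod `2` (`= Λ ⊗ 𝔽₂` up to pairs). [folklore] -/
def face2 (hc2 : c * c = 1) : Submodule (ZMod 2) (CMF G c →₀ ZMod 2) := Submodule.span (ZMod 2) (faces2 c hc2)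

/-- `pair2 = 𝔽₂⟨pairs⟩`. [folklore] -/
def pair2 : Submodule (ZMod 2) (CMF G c →₀ ZMod 2) := Submodule.span (ZMod 2) (red c '' pairSet c)

/-- The coboundaries `f·Q⁻¹ − f` of faces mod `2`. [folklore] -/
def cobdry (hc2 : c * c = 1) : Set (CMF G c →₀ ZMod 2) :=
  {y | ∃ (Q : G) (x : CMF G c →₀ ZMod 2), x ∈ faces2 c hc2 ∧ y = Finsupp.mapDomain (rt c Q) x - x}

/-- `aug2 = 𝔽₂⟨f·Q⁻¹ − f⟩ = I_G · face2`, the augmentation (coboundary) submodule of the face lattice mod `2`. [folklore] -/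
def aug2 (hc2 : c * c = 1) : Submodule (ZMod 2) (CMF G c →₀ ZMod 2) := Submodule.span (ZMod 2) (cobdry c hc2)

/-- `hodge2 = face2 + pair2`, the Hodge lattice mod `2`. [folklore] -/
def hodge2 (hc2 : c * c = 1) : Submodule (ZMod 2) (CMF G c →₀ ZMod 2) := face2 c hc2 ⊔ pair2 c

/-- `rad2 = pair2 + aug2`: pairs plus coboundaries — the kernel of the projection of `hodge2` to the coinvariant fibre. [folklore] -/
def rad2 (hc2 : c * c = 1) : Submodule (ZMod 2) (CMF G c →₀ ZMod 2) := pair2 c ⊔ aug2 c hc2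

/-- The `ℤ[G]`-translates (base changes) of a family in `𝔽₂[types]`. [folklore] -/
def translates2 (S : Finset (CMF G c →₀ ZMod 2)) : Set (CMF G c →₀ ZMod 2) :=
  {y | ∃ Q : G, ∃ s ∈ S, y = Finsupp.mapDomain (rt c Q) s}

/-- `rt c 1 = id` as a function on CM types. [folklore] -/
theorem rt_one_eq_id : rt c (1 : G) = id := funext fun Ψ => rt_one c Ψ

/-- Base change along `1` is the identity on `𝔽₂[types]` (and on any `Finsupp`). [folklore] -/
theorem mapDomain_rt_one {M : Type*} [AddCommMonoid M] (x : CMF G c →₀ M) : Finsupp.mapDomain (rt c (1 : G)) x = x := by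
  rw [rt_one_eq_id, Finsupp.mapDomain_id]

/-- Base change is multiplicative on `Finsupp`s: `x·(QQ')⁻¹ = (x·Q'⁻¹)·Q⁻¹`. [folklore] -/
theorem mapDomain_rt_mul {M : Type*} [AddCommMonoid M] (Q Q' : G) (x : CMF G c →₀ M) :
    Finsupp.mapDomain (rt c (Q * Q')) x = Finsupp.mapDomain (rt c Q) (Finsupp.mapDomain (rt c Q') x) := by
  rw [← Finsupp.mapDomain_comp]
  congr 1
  funext Ψ
  exact rt_mul c Q Q' Ψ

/-- A family lies among its translates. [folklore] -/
theorem subset_translates2 (S : Finset (CMF G c →₀ ZMod 2)) : (S : Set (CMF G c →₀ ZMod 2)) ⊆ translates2 c S :=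
  fun s hs => ⟨1, s, hs, by rw [mapDomain_rt_one]⟩

/-- **Translates of translates are translates**: `𝔽₂⟨translates of S⟩` is base-change stable. [folklore] -/
theorem mapDomain_rt_mem_span_translates2 (Q : G) (S : Finset (CMF G c →₀ ZMod 2)) {x : CMF G c →₀ ZMod 2}
    (hx : x ∈ Submodule.span (ZMod 2) (translates2 c S)) :
    Finsupp.mapDomain (rt c Q) x ∈ Submodule.span (ZMod 2) (translates2 c S) := by
  have h : Submodule.map (Finsupp.lmapDomain (ZMod 2) (ZMod 2) (rt c Q)) (Submodule.span (ZMod 2) (translates2 c S)) ≤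
      Submodule.span (ZMod 2) (translates2 c S) := by
    rw [Submodule.map_span, Submodule.span_le]
    rintro _ ⟨_, ⟨Q', s, hs, rfl⟩, rfl⟩
    rw [Finsupp.lmapDomain_apply, ← mapDomain_rt_mul]
    exact Submodule.subset_span ⟨Q * Q', s, hs, rfl⟩
  exact h (Submodule.mem_map_of_mem hx)

/-- The reduction of a face is a face mod `2`. [folklore] -/
theorem red_mem_faces2 (hc2 : c * c = 1) {y : CMF G c →₀ ℤ} (hy : y ∈ gfaceSet G c hc2) : red c y ∈ faces2 c hc2 :=
  ⟨y, hy, rfl⟩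

/-- Reduction maps `ℤ⟨X⟩` into `𝔽₂⟨red X⟩`. [folklore] -/
theorem red_mem_span_of_mem_span {X : Set (CMF G c →₀ ℤ)} {y : CMF G c →₀ ℤ} (hy : y ∈ Submodule.span ℤ X) :
    red c y ∈ Submodule.span (ZMod 2) (red c '' X) := by
  have h : Submodule.map (red c) (Submodule.span ℤ X) ≤ (Submodule.span (ZMod 2) (red c '' X)).restrictScalars ℤ := by
    rw [Submodule.map_span, Submodule.span_le]
    exact fun z hz => Submodule.subset_span hz
  exact h (Submodule.mem_map_of_mem hy)

/-- Reduction maps the face span into `face2`. [folklore] -/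
theorem red_mem_face2 (hc2 : c * c = 1) {y : CMF G c →₀ ℤ} (hy : y ∈ Submodule.span ℤ (gfaceSet G c hc2)) :
    red c y ∈ face2 c hc2 :=
  red_mem_span_of_mem_span c hy

/-- Reduction maps the pair span into `pair2`. [folklore] -/
theorem red_mem_pair2 {y : CMF G c →₀ ℤ} (hy : y ∈ Submodule.span ℤ (pairSet c)) : red c y ∈ pair2 c :=
  red_mem_span_of_mem_span c hy

/-- **Reduction maps Hodge vectors into `hodge2`.** [folklore] -/
theorem red_mem_hodge2 (hc2 : c * c = 1) {y : CMF G c →₀ ℤ} (hy : y ∈ hodgeSpan c hc2) : red c y ∈ hodge2 c hc2 := by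
  obtain ⟨f, hf, q, hq, rfl⟩ := Submodule.mem_sup.mp hy
  rw [map_add]
  exact Submodule.add_mem _ (Submodule.mem_sup_left (red_mem_face2 c hc2 hf)) (Submodule.mem_sup_right (red_mem_pair2 c hq))

/-- **The base change of a face mod `2` is a face mod `2`.** [folklore] -/
theorem mapDomain_rt_mem_faces2 (hc2 : c * c = 1) (Q : G) {x : CMF G c →₀ ZMod 2} (hx : x ∈ faces2 c hc2) :
    Finsupp.mapDomain (rt c Q) x ∈ faces2 c hc2 := by
  obtain ⟨_, ⟨Φ, t, t', ht', rfl⟩, rfl⟩ := hx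
  rw [← red_mapDomain, mapDomain_rt_gface]
  exact ⟨_, ⟨_, _, _, notMem_orb_mul_inv c Q ht', rfl⟩, rfl⟩

/-- `face2` is base-change stable. [folklore] -/
theorem mapDomain_rt_mem_face2 (hc2 : c * c = 1) (Q : G) {x : CMF G c →₀ ZMod 2} (hx : x ∈ face2 c hc2) :
    Finsupp.mapDomain (rt c Q) x ∈ face2 c hc2 := by
  have h : Submodule.map (Finsupp.lmapDomain (ZMod 2) (ZMod 2) (rt c Q)) (face2 c hc2) ≤ face2 c hc2 := by
    rw [face2, Submodule.map_span, Submodule.span_le]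
    rintro _ ⟨y, hy, rfl⟩
    exact Submodule.subset_span (mapDomain_rt_mem_faces2 c hc2 Q hy)
  exact h (Submodule.mem_map_of_mem hx)

/-- For central `c`, `pair2` is base-change stable. [folklore] -/
theorem mapDomain_rt_mem_pair2 (hcen : ∀ x : G, x * c = c * x) (Q : G) {x : CMF G c →₀ ZMod 2} (hx : x ∈ pair2 c) :
    Finsupp.mapDomain (rt c Q) x ∈ pair2 c := by
  have h : Submodule.map (Finsupp.lmapDomain (ZMod 2) (ZMod 2) (rt c Q)) (pair2 c) ≤ pair2 c := by
    rw [pair2, Submodule.map_span, Submodule.span_le]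
    rintro _ ⟨_, ⟨_, ⟨Ψ, rfl⟩, rfl⟩, rfl⟩
    rw [Finsupp.lmapDomain_apply, ← red_mapDomain, mapDomain_rt_pair_eq c hcen]
    exact Submodule.subset_span ⟨_, pair_mem_pairSet c _, rfl⟩
  exact h (Submodule.mem_map_of_mem hx)

/-- For central `c`, **`hodge2` is base-change stable.** [folklore] -/
theorem mapDomain_rt_mem_hodge2 (hc2 : c * c = 1) (hcen : ∀ x : G, x * c = c * x) (Q : G) {x : CMF G c →₀ ZMod 2}
    (hx : x ∈ hodge2 c hc2) : Finsupp.mapDomain (rt c Q) x ∈ hodge2 c hc2 := by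
  obtain ⟨f, hf, q, hq, rfl⟩ := Submodule.mem_sup.mp hx
  rw [Finsupp.mapDomain_add]
  exact Submodule.add_mem _ (Submodule.mem_sup_left (mapDomain_rt_mem_face2 c hc2 Q hf))
    (Submodule.mem_sup_right (mapDomain_rt_mem_pair2 c hcen Q hq))

/-- A coboundary of a face mod `2` lies in `aug2`. [folklore] -/
theorem mapDomain_rt_sub_mem_aug2_of_mem_faces2 (hc2 : c * c = 1) (Q : G) {x : CMF G c →₀ ZMod 2} (hx : x ∈ faces2 c hc2) :
    Finsupp.mapDomain (rt c Q) x - x ∈ aug2 c hc2 :=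
  Submodule.subset_span ⟨Q, x, hx, rfl⟩

/-- **Coboundaries of `face2` lie in `aug2`** (`I_G · 𝔽₂⟨faces⟩ = 𝔽₂⟨coboundaries of faces⟩`). [folklore] -/
theorem mapDomain_rt_sub_mem_aug2 (hc2 : c * c = 1) (Q : G) {x : CMF G c →₀ ZMod 2} (hx : x ∈ face2 c hc2) :
    Finsupp.mapDomain (rt c Q) x - x ∈ aug2 c hc2 := by
  have h : Submodule.map (Finsupp.lmapDomain (ZMod 2) (ZMod 2) (rt c Q) - LinearMap.id) (face2 c hc2) ≤ aug2 c hc2 := by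
    rw [face2, Submodule.map_span, Submodule.span_le]
    rintro _ ⟨y, hy, rfl⟩
    exact mapDomain_rt_sub_mem_aug2_of_mem_faces2 c hc2 Q hy
  exact h (Submodule.mem_map_of_mem hx)

/-- `aug2 ≤ face2`: coboundaries of faces are differences of faces. [folklore] -/
theorem aug2_le_face2 (hc2 : c * c = 1) : aug2 c hc2 ≤ face2 c hc2 := by
  rw [aug2, Submodule.span_le]
  rintro _ ⟨Q, x, hx, rfl⟩
  exact Submodule.sub_mem _ (Submodule.subset_span (mapDomain_rt_mem_faces2 c hc2 Q hx)) (Submodule.subset_span hx)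

/-- **`rad2 ≤ hodge2`.** [folklore] -/
theorem rad2_le_hodge2 (hc2 : c * c = 1) : rad2 c hc2 ≤ hodge2 c hc2 :=
  sup_le (le_sup_right) ((aug2_le_face2 c hc2).trans le_sup_left)

/-- `pair2 ≤ rad2`. [folklore] -/
theorem pair2_le_rad2 (hc2 : c * c = 1) : pair2 c ≤ rad2 c hc2 := le_sup_left

/-- **Key closure property** (central `c`): the coboundary `x·Q⁻¹ − x` of ANY Hodge vector mod `2` lies in `rad2 = pairs +
coboundaries of faces`. [folklore] -/
theorem mapDomain_rt_sub_mem_rad2 (hc2 : c * c = 1) (hcen : ∀ x : G, x * c = c * x) (Q : G) {x : CMF G c →₀ ZMod 2}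
    (hx : x ∈ hodge2 c hc2) : Finsupp.mapDomain (rt c Q) x - x ∈ rad2 c hc2 := by
  obtain ⟨f, hf, q, hq, rfl⟩ := Submodule.mem_sup.mp hx
  have e : Finsupp.mapDomain (rt c Q) (f + q) - (f + q) =
      (Finsupp.mapDomain (rt c Q) f - f) + (Finsupp.mapDomain (rt c Q) q - q) := by
    rw [Finsupp.mapDomain_add]; abel
  rw [e]
  exact Submodule.add_mem _ (Submodule.mem_sup_right (mapDomain_rt_sub_mem_aug2 c hc2 Q hf))
    (pair2_le_rad2 c hc2 (Submodule.sub_mem _ (mapDomain_rt_mem_pair2 c hcen Q hq) hq))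

/-- For central `c`, `rad2` is base-change stable. [folklore] -/
theorem mapDomain_rt_mem_rad2 (hc2 : c * c = 1) (hcen : ∀ x : G, x * c = c * x) (Q : G) {x : CMF G c →₀ ZMod 2}
    (hx : x ∈ rad2 c hc2) : Finsupp.mapDomain (rt c Q) x ∈ rad2 c hc2 := by
  have e : Finsupp.mapDomain (rt c Q) x = (Finsupp.mapDomain (rt c Q) x - x) + x := by abel
  rw [e]
  exact Submodule.add_mem _ (mapDomain_rt_sub_mem_rad2 c hc2 hcen Q (rad2_le_hodge2 c hc2 hx)) hx

/-! ## §4 The coinvariant fibre `φ₂(G, c)` -/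

/-- **The coinvariant fibre** of `(G, c)`: the image of the Hodge lattice mod `2` in `𝔽₂[types] / rad2`, i.e. `hodge2` modulo
pairs and coboundaries; for central `c ≠ 1` this is `(Λ ⊗ 𝔽₂)_G = Λ/(I_G Λ + 2Λ)`, `Λ` = integer Hodge vectors modulo pairs.
[folklore] -/
def fibre (hc2 : c * c = 1) : Submodule (ZMod 2) ((CMF G c →₀ ZMod 2) ⧸ rad2 c hc2) :=
  Submodule.map (rad2 c hc2).mkQ (hodge2 c hc2)

/-- **`φ₂(G, c) := dim_𝔽₂` of the coinvariant fibre** — André-3's `fibre₂`, a choice-free invariant of `(G, c)`. [folklore] -/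
def fibreTwo (hc2 : c * c = 1) : ℕ := Module.finrank (ZMod 2) ↥(fibre c hc2)

/-- The class of a Hodge vector mod `2` lies in the fibre. [folklore] -/
theorem mkQ_mem_fibre (hc2 : c * c = 1) {x : CMF G c →₀ ZMod 2} (hx : x ∈ hodge2 c hc2) :
    (rad2 c hc2).mkQ x ∈ fibre c hc2 :=
  Submodule.mem_map_of_mem hx

/-- The fibre is also the image of `face2` alone (pairs die in the quotient). [folklore] -/
theorem fibre_eq_map_face2 (hc2 : c * c = 1) : fibre c hc2 = Submodule.map (rad2 c hc2).mkQ (face2 c hc2) := by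
  rw [fibre, hodge2, Submodule.map_sup]
  refine le_antisymm (sup_le le_rfl ?_) le_sup_left
  rintro _ ⟨q, hq, rfl⟩
  have h0 : (rad2 c hc2).mkQ q = 0 := by
    rw [← LinearMap.mem_ker, Submodule.ker_mkQ]
    exact pair2_le_rad2 c hc2 hq
  rw [h0]
  exact Submodule.zero_mem _

/-- **`dim rad2 + φ₂ = dim hodge2`.** [folklore] -/
theorem finrank_rad2_add_fibreTwo (hc2 : c * c = 1) :
    Module.finrank (ZMod 2) ↥(rad2 c hc2) + fibreTwo c hc2 = Module.finrank (ZMod 2) ↥(hodge2 c hc2) := by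
  have h1 := LinearMap.finrank_range_add_finrank_ker (V := ↥(hodge2 c hc2)) ((rad2 c hc2).mkQ.domRestrict (hodge2 c hc2))
  rw [LinearMap.range_domRestrict, LinearMap.ker_domRestrict, Submodule.ker_mkQ,
    (Submodule.comapSubtypeEquivOfLe (rad2_le_hodge2 c hc2)).finrank_eq] at h1
  rw [fibreTwo, fibre]
  omega

/-- **The counting form of `φ₂`**: if `hodge2 ≤ rad2 ⊔ T` for a subspace `T`, then `φ₂ ≤ dim T`. [folklore] -/
theorem fibreTwo_le_finrank_of_hodge2_le (hc2 : c * c = 1) {T : Submodule (ZMod 2) (CMF G c →₀ ZMod 2)}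
    (hT : hodge2 c hc2 ≤ rad2 c hc2 ⊔ T) : fibreTwo c hc2 ≤ Module.finrank (ZMod 2) ↥T := by
  have h1 : Module.finrank (ZMod 2) ↥(hodge2 c hc2) ≤ Module.finrank (ZMod 2) ↥(rad2 c hc2 ⊔ T) := Submodule.finrank_mono hT
  have h2 := Submodule.finrank_add_le_finrank_add_finrank (rad2 c hc2) T
  have h3 := finrank_rad2_add_fibreTwo c hc2
  omega

end

end Summit.HodgeConjecture.CorCM.Census.Coinvariant
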